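import Mathlib
import HarnessLib

/-!
# Route `WeakCouplingBCS` / `KLProgramme` — definitions: kernel-checkable POLYGON CERTIFICATES for the area of the
# free square-lattice Fermi sea (certified fillings `n(μ)` of `ε₀ = squareDispersion 1 0`)

For `c > 0` the Fermi sea of the nearest-neighbour band at energy `μ = -2c`, read in the coordinates `(k₀, k₁)`, is
the convex set `R_c = {(x, y) | |x + y| < π, |x - y| < π, c < cos x + cos y}` (`convex_fermiSeaCoord`), and the
filling is `n(-2c) = 2 vol(R_c) / (2π)²` (`kl_mu_filling_eq`).  This module only DEFINES the data formats and the
Boolean checkers of two kinds of area certificates, decided by `decide +kernel` in the record files; their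
soundness is proved in `WeakCouplingBCSKlCertFermiSeaPolygonSound.lean`:

* `FSPoly.ICert` — an INSCRIBED polygon: vertices `(x_j, ±y_j)` with rational coordinates, `x_j` increasing,
  each certified inside `R_c` by the degree-`14` Taylor minorant of `cos` over `ℚ`; by convexity the symmetric
  trapezoids between consecutive vertices lie in `R_c`, so `ICert.area ≤ vol R_c`.
* `FSPoly.OCert` — a CIRCUMSCRIBED union of tangent trapezoids: pieces `x ∈ (x_i, x_{i+1}]`, `|y| ≤ yp_i + d_i (x - x_i)`
  (and their mirror images `x ↦ -x`), where `yp_i ≥ Y(x_i) := arccos (c - cos x_i)` and `0 ≥ d_i ≥ Y'(x_i)` are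
  certified by rational Taylor enclosures of `cos`; by the supporting-half-plane property of the convex set `R_c`
  at the boundary point `(x_i, Y(x_i))` every piece contains the part of `R_c` over its `x`-interval, so
  `vol R_c ≤ OCert.area`.

All functions here are computable over `ℚ` (structural recursion only), so that `ICert.check` / `OCert.check`
reduce in the kernel.  No axioms, no analysis. [folklore]
-/

-- the tree's namespace `Summit.<Summit>.<Problem>.Theorems` repeats the summit name by design (D-0017)
set_option linter.dupNamespace false

namespace Summit.HubbardSuperconductivity.HubbardSuperconductivity.Theorems

namespace FSPoly

/-! ### Rational Taylor polynomials of the cosine -/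

/-- The Taylor polynomial `T_M(x) = ∑_{i ≤ M} (-1)^i x^{2i} / (2i)!` of `cos`, of degree `2M`, evaluated over `ℚ`
(structural recursion on `M`; cast to `ℝ` it is the raw finite sum of `Literature…TaylorCosineMinorants`). [folklore] -/
def cosTaylorQ : ℕ → ℚ → ℚ
  | 0, _ => 1
  | M + 1, x => cosTaylorQ M x + (-1) ^ (M + 1) * x ^ (2 * (M + 1)) / ((2 * (M + 1)).factorial : ℚ)

/-- Degree-`14` Taylor MINORANT of `cos` over `ℚ` (`M = 7`, odd: `cosLoQ x ≤ cos x` for every real `x`). [folklore] -/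
def cosLoQ (x : ℚ) : ℚ := cosTaylorQ 7 x

/-- Degree-`16` Taylor MAJORANT of `cos` over `ℚ` (`M = 8`, even: `cos x ≤ cosUpQ x` for every real `x`). [folklore] -/
def cosUpQ (x : ℚ) : ℚ := cosTaylorQ 8 x

/-- A rational lower bound of `π` used by the checkers (`3.141592 < π`, Mathlib `Real.pi_gt_d6`). [folklore] -/
def piLoQ : ℚ := 3141592 / 1000000

/-! ### The planar sets -/

/-- The free Fermi sea at level `c` in coordinates: `R_c = {(x, y) | |x + y| < π, |x - y| < π, c < cos x + cos y}`
(for `c > 0` this is `{ε₀ < -2c} ∩ BZ` read through `k ↦ (k₀, k₁)`; the set of `convex_fermiSeaCoord`). [folklore] -/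
def fermiSeaCoord (c : ℝ) : Set (ℝ × ℝ) :=
  {q : ℝ × ℝ | |q.1 + q.2| < Real.pi ∧ |q.1 - q.2| < Real.pi ∧ c < Real.cos q.1 + Real.cos q.2}

/-- The symmetric trapezoid over `(x₀, x₁]` with heights `y₀` at `x₀` and `y₁` at `x₁`:
`{(x, y) | x₀ < x ≤ x₁, |y| < y₀ + (y₁ - y₀)/(x₁ - x₀) · (x - x₀)}` (the shape of `volume_trapezoid`). [folklore] -/
def trap (x₀ x₁ y₀ y₁ : ℝ) : Set (ℝ × ℝ) :=
  regionBetween (fun x => -(y₀ + (y₁ - y₀) / (x₁ - x₀) * (x - x₀)))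
    (fun x => y₀ + (y₁ - y₀) / (x₁ - x₀) * (x - x₀)) (Set.Ioc x₀ x₁)

/-! ### Inscribed polygon certificates -/

/-- A vertex `(x, y)` of an inscribed polygon (rational coordinates; the mirror vertex `(x, -y)` is implied). [folklore] -/
structure IVert where
  /-- abscissa -/
  x : ℚ
  /-- ordinate (`≥ 0`) -/
  y : ℚ

/-- An inscribed-polygon certificate for the Fermi sea at level `c`: the upper vertices from left to right. [folklore] -/
structure ICert where
  /-- the level `c` (energy `μ = -2c`) -/
  c : ℚ
  /-- the upper vertices `(x_j, y_j)`, `x_j` strictly increasing -/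
  vs : List IVert

/-- A vertex is certified inside `R_c`: `y ≥ 0`, `|x| + y < 3.141592` and `c < T₇(x) + T₇(y)` (Taylor minorants). [folklore] -/
def IVert.ok (c : ℚ) (v : IVert) : Bool :=
  decide (0 ≤ v.y) && decide (|v.x| + v.y < piLoQ) && decide (c < cosLoQ v.x + cosLoQ v.y)

/-- The vertex `v` and all later vertices `rest` certified, abscissae strictly increasing (structural recursion on
`rest`, current vertex carried). [folklore] -/
def ICert.chainOK (c : ℚ) : IVert → List IVert → Bool
  | v, [] => v.ok c
  | v, w :: rest => v.ok c && decide (v.x < w.x) && ICert.chainOK c w rest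

/-- The inscribed-polygon checker: `0 < c`, at least one vertex, and the vertex chain is certified. [folklore] -/
def ICert.check (C : ICert) : Bool :=
  decide (0 < C.c) &&
    match C.vs with
    | [] => false
    | v :: rest => ICert.chainOK C.c v rest

/-- Area of the inscribed polygon from vertex `v` on: `∑_j (x_{j+1} - x_j)(y_j + y_{j+1})` (symmetric trapezoids).
[folklore] -/
def ICert.areaList : IVert → List IVert → ℚ
  | _, [] => 0
  | v, w :: rest => (w.x - v.x) * (v.y + w.y) + ICert.areaList w rest

/-- Area of the inscribed polygon of the certificate. [folklore] -/
def ICert.area (C : ICert) : ℚ :=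
  match C.vs with
  | [] => 0
  | v :: rest => ICert.areaList v rest

/-- The inscribed polygon from vertex `v` on, as a set: the union of the symmetric trapezoids between consecutive
vertices. [folklore] -/
noncomputable def ICert.polygon : IVert → List IVert → Set (ℝ × ℝ)
  | _, [] => ∅
  | v, w :: rest => trap (v.x : ℝ) (w.x : ℝ) (v.y : ℝ) (w.y : ℝ) ∪ ICert.polygon w rest

/-! ### Circumscribed tangent-trapezoid certificates -/

/-- A tangent piece: left end `x` (`≥ 0`), a rational upper bound `yp ≥ arccos (c - cos x)` of the Fermi curve there,
a rational slope `d` with `0 ≥ d ≥ -sin x / sin (arccos (c - cos x))` (the slope of the curve at `x`), and three stored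
rational cosine bounds `cl ≤ cos x ≤ cu`, `cos yp ≤ cuy` (re-certified by the checker against the Taylor polynomials,
so that each polynomial is evaluated once in the kernel). [folklore] -/
structure OPiece where
  /-- left end of the piece -/
  x : ℚ
  /-- certified upper bound of the curve height `Y(x)` -/
  yp : ℚ
  /-- certified upper bound of the curve slope `Y'(x)`, nonpositive -/
  d : ℚ
  /-- stored lower bound of `cos x` -/
  cl : ℚ
  /-- stored upper bound of `cos x` -/
  cu : ℚ
  /-- stored upper bound of `cos yp` -/
  cuy : ℚ

/-- A circumscribed certificate for the Fermi sea at level `c`: tangent pieces on `[0, xN]` with `xN ≥ arccos (c - 1)`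
(the `x`-extent of the sea); the pieces are mirrored to `x ≤ 0` by the checker's consumer. [folklore] -/
structure OCert where
  /-- the level `c` (energy `μ = -2c`) -/
  c : ℚ
  /-- the tangent pieces, left ends strictly increasing from `0` -/
  ps : List OPiece
  /-- right end, at least the `x`-extent `arccos (c - 1)` of the sea -/
  xN : ℚ

/-- Certified lower bound of `(c - cos x)²` from the stored enclosure `cl ≤ cos x ≤ cu`. [folklore] -/
def OPiece.mlo (c : ℚ) (p : OPiece) : ℚ :=
  (max 0 (max (p.cl - c) (c - p.cu))) ^ 2

/-- Certified lower bound of `sin² x = 1 - cos² x` from the stored enclosure. [folklore] -/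
def OPiece.s2lo (p : OPiece) : ℚ :=
  1 - max (p.cu ^ 2) (p.cl ^ 2)

/-- The per-piece test, `x'` = right end of the piece: (e) the stored cosine bounds are certified by the Taylor
polynomials, `cl ≤ T₇(x)`, `T₈(x) ≤ cu`, `T₈(yp) ≤ cuy`; (o) `0 ≤ x < x'`, `x ≤ 3.141592` and `-1 < c - cos x < 1`;
(a) `0 ≤ yp ≤ 3.141592` and `cos yp ≤ c - cos x` (so `arccos (c - cos x) ≤ yp`); (b) `d ≤ 0` and `d² (1 - mlo) ≤ s2lo`
(so `-sin x / sin Y(x) ≤ d`); (c) the top is nonnegative at the right end. [folklore] -/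
def OPiece.ok (c : ℚ) (p : OPiece) (x' : ℚ) : Bool :=
  decide (p.cl ≤ cosLoQ p.x) && decide (cosUpQ p.x ≤ p.cu) && decide (cosUpQ p.yp ≤ p.cuy) &&
  decide (0 ≤ p.x) && decide (p.x < x') && decide (p.x ≤ piLoQ) &&
  decide (c - p.cl < 1) && decide (-1 < c - p.cu) &&
  decide (0 ≤ p.yp) && decide (p.yp ≤ piLoQ) && decide (p.cuy ≤ c - p.cu) &&
  decide (p.d ≤ 0) && decide (p.d ^ 2 * (1 - p.mlo c) ≤ p.s2lo) &&
  decide (0 ≤ p.yp + p.d * (x' - p.x))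

/-- The piece `p` and all later pieces `rest` certified, each against the left end of its successor (the last
against `xN`; structural recursion on `rest`, current piece carried). [folklore] -/
def OCert.chainOK (c xN : ℚ) : OPiece → List OPiece → Bool
  | p, [] => p.ok c xN
  | p, p' :: rest => p.ok c p'.x && OCert.chainOK c xN p' rest

/-- The circumscribed checker: `0 < c`, there is a first piece and it starts at `0`, the chain is certified, and
`0 ≤ xN ≤ 3.141592`, `cos xN ≤ c - 1` certified (so `arccos (c - 1) ≤ xN`). [folklore] -/
def OCert.check (C : OCert) : Bool :=
  decide (0 < C.c) && decide (0 ≤ C.xN) && decide (C.xN ≤ piLoQ) && decide (cosUpQ C.xN ≤ C.c - 1) &&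
    match C.ps with
    | [] => false
    | p :: rest => decide (p.x = 0) && OCert.chainOK C.c C.xN p rest

/-- Area of the circumscribed union from piece `p` on: `2 ∑_i h_i (2 yp_i + d_i h_i)`, `h_i = x_{i+1} - x_i` (the
factor `2` counts the mirror images `x ↦ -x`). [folklore] -/
def OCert.areaList (xN : ℚ) : OPiece → List OPiece → ℚ
  | p, [] => 2 * ((xN - p.x) * (2 * p.yp + p.d * (xN - p.x)))
  | p, p' :: rest => 2 * ((p'.x - p.x) * (2 * p.yp + p.d * (p'.x - p.x))) + OCert.areaList xN p' rest

/-- Area of the circumscribed union of the certificate. [folklore] -/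
def OCert.area (C : OCert) : ℚ :=
  match C.ps with
  | [] => 0
  | p :: rest => OCert.areaList C.xN p rest

/-- The two trapezoids of a piece with right end `x'`: over `(x, x']` and its mirror over `(-x', -x]`. [folklore] -/
noncomputable def OPiece.traps (p : OPiece) (x' : ℚ) : Set (ℝ × ℝ) :=
  trap (p.x : ℝ) (x' : ℝ) (p.yp : ℝ) ((p.yp + p.d * (x' - p.x) : ℚ) : ℝ) ∪
    trap (-(x' : ℝ)) (-(p.x : ℝ)) ((p.yp + p.d * (x' - p.x) : ℚ) : ℝ) (p.yp : ℝ)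

/-- The circumscribed union from piece `p` on, as a set. [folklore] -/
noncomputable def OCert.union (xN : ℚ) : OPiece → List OPiece → Set (ℝ × ℝ)
  | p, [] => p.traps xN
  | p, p' :: rest => p.traps p'.x ∪ OCert.union xN p' rest

end FSPoly

end Summit.HubbardSuperconductivity.HubbardSuperconductivity.Theorems
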